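import Literature.Probability.LatticeModels.LatticeLaplacian
import Literature.Probability.LatticeModels.MedialInterfaceProofs
import HarnessLib

/-!
# Level sets of lattice super- and sub-harmonic functions reach the boundary (input of CHI Lemma 3.10)

Topic `Literature/Probability/LatticeModels`. In the proof of Lemma 3.10 of Chelkak–Hongler–Izyurov
(Ann. of Math. 181 (2015), §3.4) one takes "some nearest-neighbor path γ_δ, running from z^max … along
which the function H decreases and which may only end up at a_j" — for a lattice superharmonic
function a non-increasing path from any site can be continued until superharmonicity fails. This file
gives the clean finite form of that step on `ℤ²`:

* `sum_latticeLaplacian_eq_boundary_sum`: `∑_{v ∈ K} Δ H (v) = ∑_{v ∈ K, v + e_k ∉ K} (H(v + e_k) - H v)`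
  (the internal increments cancel in pairs);
* **`exists_exit_le_of_superharmonic`**: if `Δ H ≤ 0` on a nonempty finite `K` then some site of `K`
  has a neighbour OUTSIDE `K` where `H` is not larger; dually `exists_exit_ge_of_subharmonic`;
* `ReachIn T u v` (joined by a lattice walk inside `T`), the component `reachSet`, and
  **`exists_exit_of_levelSet_superharmonic`**: for `H` superharmonic at the sites of the level set
  `{v ∈ T | H v ≤ L}` reachable from `u₀` inside it, some site reachable from `u₀` inside the level
  set has a lattice neighbour `w ∉ T` with `H w ≤ L` — the path "may only end" where `T` ends
  (at the marked point, or at the outer annulus); `exists_exit_of_levelSet_subharmonic` dually.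

Everything is proved; no named fact.

## References

* D. Chelkak, C. Hongler, K. Izyurov, Ann. of Math. 181 (2015), proof of Lemma 3.10
  [ChelkakHonglerIzyurovAnnals2015].
* G. F. Lawler, V. Limic, *Random Walk: A Modern Introduction* (2010), §6.1 (maximum principle)
  [LawlerLimic2010].
-/

noncomputable section

namespace Literature.Probability.LatticeModels

open Finset SimpleGraph

/-! ### The sum of the Laplacian over a finite set -/

/-- **The internal increments cancel**: `∑_{v ∈ K} ∑_k 1[v + e_k ∈ K] (H(v + e_k) - H v) = 0`. [folklore] -/
theorem sum_internal_increments_eq_zero (H : Site 2 → ℝ) (K : Finset (Site 2)) :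
    ∑ v ∈ K, ∑ k : Fin 4, (if v + cornerUnit k ∈ K then H (v + cornerUnit k) - H v else 0) = 0 := by
  classical
  rw [← Finset.sum_product']
  rw [← Finset.sum_filter]
  refine Finset.sum_involution (fun q _ => (q.1 + cornerUnit q.2, q.2 + 2)) ?_ ?_ ?_ ?_
  · rintro ⟨v, k⟩ hq
    simp only [cornerUnit_add_two, add_neg_cancel_right]
    ring
  · rintro ⟨v, k⟩ _ _ h
    have : k + 2 = k := congrArg Prod.snd h
    revert this; fin_cases k <;> decide
  · rintro ⟨v, k⟩ hq
    simp only [Finset.mem_filter, Finset.mem_product, Finset.mem_univ, and_true] at hq ⊢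
    refine ⟨hq.2, ?_⟩
    rw [cornerUnit_add_two, add_neg_cancel_right]; exact hq.1
  · rintro ⟨v, k⟩ _
    simp only [cornerUnit_add_two, add_neg_cancel_right, Prod.mk.injEq, true_and]
    rw [add_assoc, show (2 : Fin 4) + 2 = 0 from rfl, add_zero]

/-- **`∑_{v ∈ K} Δ H (v)` is the sum of the increments across the boundary edges of `K`.** [folklore] -/
theorem sum_latticeLaplacian_eq_boundary_sum (H : Site 2 → ℝ) (K : Finset (Site 2)) :
    ∑ v ∈ K, latticeLaplacian H v =
      ∑ v ∈ K, ∑ k : Fin 4, (if v + cornerUnit k ∈ K then 0 else H (v + cornerUnit k) - H v) := by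
  classical
  have h0 := sum_internal_increments_eq_zero H K
  have e : ∀ v ∈ K, latticeLaplacian H v = ∑ k : Fin 4, (if v + cornerUnit k ∈ K then H (v + cornerUnit k) - H v else 0) +
      ∑ k : Fin 4, (if v + cornerUnit k ∈ K then 0 else H (v + cornerUnit k) - H v) := by
    intro v _
    rw [latticeLaplacian, ← Finset.sum_add_distrib]
    refine Finset.sum_congr rfl fun k _ => ?_
    split_ifs <;> ring
  rw [Finset.sum_congr rfl e, Finset.sum_add_distrib, h0, zero_add]

/-- A nonempty finite set of sites has a boundary edge: the site with the largest first coordinate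
has its east neighbour outside. [folklore] -/
theorem exists_add_cornerUnit_not_mem {K : Finset (Site 2)} (hne : K.Nonempty) : ∃ v ∈ K, v + cornerUnit 0 ∉ K := by
  obtain ⟨v, hv, hmax⟩ := K.exists_max_image (fun v => v 0) hne
  refine ⟨v, hv, fun h => ?_⟩
  have := hmax _ h
  simp [cornerUnit] at this

/-- **Exit lemma, superharmonic form**: if `Δ H ≤ 0` at every site of a nonempty finite `K`, some site
of `K` has a lattice neighbour outside `K` at which `H` is not larger. (Otherwise every boundary
increment is positive and `∑_K Δ H > 0`.) [cite: ChelkakHonglerIzyurovAnnals2015, proof of Lemma 3.10] -/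
theorem exists_exit_le_of_superharmonic {H : Site 2 → ℝ} {K : Finset (Site 2)} (hne : K.Nonempty)
    (hsup : ∀ v ∈ K, latticeLaplacian H v ≤ 0) :
    ∃ v ∈ K, ∃ k : Fin 4, v + cornerUnit k ∉ K ∧ H (v + cornerUnit k) ≤ H v := by
  classical
  by_contra hcon
  push Not at hcon
  have hle : ∑ v ∈ K, latticeLaplacian H v ≤ 0 := Finset.sum_nonpos hsup
  rw [sum_latticeLaplacian_eq_boundary_sum] at hle
  -- every boundary term is positive, and there is one
  have hterm : ∀ v ∈ K, ∀ k : Fin 4, 0 ≤ (if v + cornerUnit k ∈ K then 0 else H (v + cornerUnit k) - H v) := by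
    intro v hv k
    split_ifs with h
    · exact le_rfl
    · have := hcon v hv k h; linarith
  obtain ⟨v₀, hv₀, hout⟩ := exists_add_cornerUnit_not_mem hne
  have hpos : 0 < ∑ v ∈ K, ∑ k : Fin 4, (if v + cornerUnit k ∈ K then 0 else H (v + cornerUnit k) - H v) := by
    apply Finset.sum_pos'
    · exact fun v hv => Finset.sum_nonneg fun k _ => hterm v hv k
    · refine ⟨v₀, hv₀, Finset.sum_pos' (fun k _ => hterm v₀ hv₀ k) ⟨0, Finset.mem_univ _, ?_⟩⟩
      rw [if_neg hout]
      have := hcon v₀ hv₀ 0 hout; linarith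
  linarith

/-- **Exit lemma, subharmonic form.** [cite: ChelkakHonglerIzyurovAnnals2015, proof of Lemma 3.10] -/
theorem exists_exit_ge_of_subharmonic {H : Site 2 → ℝ} {K : Finset (Site 2)} (hne : K.Nonempty)
    (hsub : ∀ v ∈ K, 0 ≤ latticeLaplacian H v) :
    ∃ v ∈ K, ∃ k : Fin 4, v + cornerUnit k ∉ K ∧ H v ≤ H (v + cornerUnit k) := by
  have hsup : ∀ v ∈ K, latticeLaplacian (-H) v ≤ 0 := fun v hv => by
    rw [latticeLaplacian_neg]; linarith [hsub v hv]
  obtain ⟨v, hv, k, hk, hle⟩ := exists_exit_le_of_superharmonic hne hsup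
  exact ⟨v, hv, k, hk, by simpa using hle⟩

/-! ### Walks inside a set and the component of a site -/

/-- `u` and `v` are **joined by a lattice walk inside `T`**. [folklore] -/
def ReachIn (T : Set (Site 2)) (u v : Site 2) : Prop := ∃ W : (zdGraph 2).Walk u v, ∀ z ∈ W.support, z ∈ T

namespace ReachIn

variable {T : Set (Site 2)} {u v w : Site 2}

/-- Bookkeeping (`refl`). [folklore] -/
theorem refl (hu : u ∈ T) : ReachIn T u u := ⟨Walk.nil, fun z hz => by simp at hz; rw [hz]; exact hu⟩

/-- Bookkeeping (`mem_left`). [folklore] -/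
theorem mem_left (h : ReachIn T u v) : u ∈ T := by
  obtain ⟨W, hW⟩ := h; exact hW _ W.start_mem_support

/-- Bookkeeping (`mem_right`). [folklore] -/
theorem mem_right (h : ReachIn T u v) : v ∈ T := by
  obtain ⟨W, hW⟩ := h; exact hW _ W.end_mem_support

/-- Extending a walk inside `T` by one lattice step to a site of `T`. [folklore] -/
theorem step (h : ReachIn T u v) (hadj : (zdGraph 2).Adj v w) (hw : w ∈ T) : ReachIn T u w := by
  obtain ⟨W, hW⟩ := h
  refine ⟨W.append (Walk.cons hadj Walk.nil), fun z hz => ?_⟩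
  rw [Walk.support_append] at hz
  rcases List.mem_append.1 hz with hz | hz
  · exact hW z hz
  · simp at hz; rw [hz]; exact hw

/-- Bookkeeping (`mono`). [folklore] -/
theorem mono {T' : Set (Site 2)} (h : ReachIn T u v) (hT : T ⊆ T') : ReachIn T' u v := by
  obtain ⟨W, hW⟩ := h; exact ⟨W, fun z hz => hT (hW z hz)⟩

end ReachIn

/-- **The exit lemma for level sets, superharmonic form** (the path of CHI's Lemma 3.10 "may only end
up at `a_j`"): let `T` be a finite set of sites, `L` a level, `u₀ ∈ T` with `H u₀ ≤ L`, and suppose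
`Δ H ≤ 0` at every site of the level set `{v ∈ T | H v ≤ L}` that is joined to `u₀` inside this level
set. Then some site `v` joined to `u₀` inside the level set has a lattice neighbour `w ∉ T` with
`H w ≤ H v ≤ L`. [cite: ChelkakHonglerIzyurovAnnals2015, proof of Lemma 3.10] -/
theorem exists_exit_of_levelSet_superharmonic {H : Site 2 → ℝ} {T : Set (Site 2)} (hT : T.Finite) {L : ℝ}
    {u₀ : Site 2} (hu₀ : u₀ ∈ T) (hL : H u₀ ≤ L)
    (hsup : ∀ v, ReachIn {x | x ∈ T ∧ H x ≤ L} u₀ v → latticeLaplacian H v ≤ 0) :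
    ∃ v w : Site 2, ReachIn {x | x ∈ T ∧ H x ≤ L} u₀ v ∧ (zdGraph 2).Adj v w ∧ w ∉ T ∧ H w ≤ H v := by
  classical
  set T' : Set (Site 2) := {x | x ∈ T ∧ H x ≤ L} with hT'
  have hfin : {v | ReachIn T' u₀ v}.Finite := hT.subset fun v hv => (ReachIn.mem_right hv).1
  set K : Finset (Site 2) := hfin.toFinset with hK
  have hmemK : ∀ v, v ∈ K ↔ ReachIn T' u₀ v := fun v => by rw [hK, Set.Finite.mem_toFinset]; rfl
  have hne : K.Nonempty := ⟨u₀, (hmemK _).2 (ReachIn.refl ⟨hu₀, hL⟩)⟩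
  obtain ⟨v, hv, k, hk, hle⟩ := exists_exit_le_of_superharmonic hne (fun v hv => hsup v ((hmemK v).1 hv))
  have hvR := (hmemK v).1 hv
  refine ⟨v, v + cornerUnit k, hvR, (cSrc_mem_edgeSet (v, k)), fun hwT => hk ?_, hle⟩
  exact (hmemK _).2 (hvR.step ((cSrc_mem_edgeSet (v, k))) ⟨hwT, hle.trans (ReachIn.mem_right hvR).2⟩)

/-- **The exit lemma for level sets, subharmonic form**: with `Δ H ≥ 0` on the upper level set
`{v ∈ T | L ≤ H v}` reachable from `u₀`, some reachable site has a neighbour `w ∉ T` with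
`H v ≤ H w`. [cite: ChelkakHonglerIzyurovAnnals2015, proof of Lemma 3.10] -/
theorem exists_exit_of_levelSet_subharmonic {H : Site 2 → ℝ} {T : Set (Site 2)} (hT : T.Finite) {L : ℝ}
    {u₀ : Site 2} (hu₀ : u₀ ∈ T) (hL : L ≤ H u₀)
    (hsub : ∀ v, ReachIn {x | x ∈ T ∧ L ≤ H x} u₀ v → 0 ≤ latticeLaplacian H v) :
    ∃ v w : Site 2, ReachIn {x | x ∈ T ∧ L ≤ H x} u₀ v ∧ (zdGraph 2).Adj v w ∧ w ∉ T ∧ H v ≤ H w := by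
  have e : {x | x ∈ T ∧ L ≤ H x} = {x | x ∈ T ∧ (-H) x ≤ -L} := by
    ext x; simp
  have hsup : ∀ v, ReachIn {x | x ∈ T ∧ (-H) x ≤ -L} u₀ v → latticeLaplacian (-H) v ≤ 0 := fun v hv => by
    rw [latticeLaplacian_neg]; rw [← e] at hv; linarith [hsub v hv]
  obtain ⟨v, w, hR, hadj, hw, hle⟩ := exists_exit_of_levelSet_superharmonic (H := -H) hT hu₀ (by simpa using hL) hsup
  rw [← e] at hR
  exact ⟨v, w, hR, hadj, hw, by simpa using hle⟩

end Literature.Probability.LatticeModels
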